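import Literature.Probability.LatticeModels.LoopO1
import Literature.Probability.LatticeModels.ModifiedSimonInequality
import Literature.Probability.LatticeModels.IsingThermodynamics
import Summits.CriticalPhenomena.Ising3DConformalLimit.Theorems.FKParityRobustnessDefs
import Summits.CriticalPhenomena.Ising3DConformalLimit.Theorems.FKParityRobustnessDepletionBoundHTE
import HarnessLib

/-!
# Crux IndependentStrandsJoin (stmt-CriticalPhenomena-14625), line Sketch — stub transfer

Route `FKParityRobustness`, sub-problem `Ising3DConformalLimit`; registered stub `stub_transfer` of
the skeleton of the line `Sketch` (the tetrahedral sandwich).  The stub is the ALGEBRAIC TRANSFER: the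
separation bound, the pairing symmetry bound, the box pairing symmetry and the lattice `U₄` clause
`TetraU4Lattice` (all four hypotheses, inlined; they are the conclusions of the neighbouring stubs)
imply the body of the route decl `IndependentStrandsJoin`, with constant `c/3` and the same `N₀(l)`.

The statement only mentions tree (`Literature`) objects, so this file does not import the route's
`Theses` module (it is self-contained over `LoopO1`, `ModifiedSimonInequality`, `IsingThermodynamics`
and the two landed helper files `FKParityRobustnessDefs`, `FKParityRobustnessDepletionBoundHTE`).

Proof (one page of algebra in the box `Λ_N`, `G = (zdGraph 3).comap Subtype.val`, `β = β_c(3)`,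
`t = tanh β ≥ 0`, `Z^B = loopO1PartitionFunction G t B`, `Z⁰ = Z^∅ > 0`):

* the high-temperature expansion `⟨σ_B⟩^free_G = Z^B / Z⁰` (`isingCorr_free_eq_hteSum_div` and
  `DepletionBound.loopO1PartitionFunction_eq_hteSum`)
  gives `nPoint = Z^{0123}/Z⁰` (for injective `a`, `spinMonomial a = spinProduct (image a)`) and
  `twoPoint (a i) (a j) = Z^{ij}/Z⁰`, so
  `U₄ · (Z⁰)² = Z^{0123} Z⁰ − Z^{01}Z^{23} − Z^{02}Z^{13} − Z^{03}Z^{12} = Z^{0123} Z⁰ − 3 Z^{01}Z^{23}`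
  by the two `Z`-identities of the symmetry hypothesis;
* `TetraU4Lattice`: `U₄ ≤ −c ⟨σ₀σ₁⟩⟨σ₂σ₃⟩ = −c Z^{01}Z^{23}/(Z⁰)²`, hence
  `Z^{0123} Z⁰ ≤ (3 − c) Z^{01}Z^{23}`;
* separation (`Z^{01}Z^{23} − meetSum ≤ sepSum · Z⁰`) and symmetry (`3 sepSum ≤ Z^{0123}`):
  `3 (Z^{01}Z^{23} − meetSum) ≤ Z^{0123} Z⁰ ≤ (3 − c) Z^{01}Z^{23}`, i.e. `(c/3) Z^{01}Z^{23} ≤ meetSum`;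
* `meetSum ≤ jointSum` termwise: a common vertex `v` of the `a₀`-cluster of `F₁` and the
  `a₂`-cluster of `F₂` joins `a₀ ↝_{F₁} v ↝_{F₂} a₂` inside `F₁ ∪ F₂`.

Sources: M. Aizenman, Comm. Math. Phys. 86 (1982) [AizenmanCMP1982]; H. Duminil-Copin, lectures on
the Ising and Potts models, §2.2.1 (high-temperature expansion) [DuminilCopinECM2018];
U. T. Hansen, J. Jiang, F. R. Klausen, arXiv:2506.10765, §2 (sourced loop O(1)) [HansenJiangKlausen2025].
Theorem-only file; helpers in the sub-namespace `StubTransfer`.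
-/

noncomputable section

open Finset SimpleGraph
open Literature.Probability.LatticeModels

namespace Summit.CriticalPhenomena.Ising3DConformalLimit.Theorems

open scoped Classical BigOperators

namespace StubTransfer

variable {V : Type*} [Fintype V] [DecidableEq V] (G : SimpleGraph V) [DecidableRel G.Adj]

/-- **`meetSum ≤ jointSum` termwise.**  If the `a₀`-cluster of `F₁` and the `a₂`-cluster of `F₂`
share a vertex `v`, then `a₀ ↝ v ↝ a₂` inside `F₁ ∪ F₂`; the weights `t^{|F₁|+|F₂|}` are `≥ 0`. -/
theorem meetSum_le_jointSum {t : ℝ} (ht : 0 ≤ t) (a : Fin 4 → V) :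
    (∑ F₁ ∈ tJoins G Set.univ {a 0, a 1}, ∑ F₂ ∈ tJoins G Set.univ {a 2, a 3},
        if ∃ v : V, (SimpleGraph.fromEdgeSet (↑F₁ : Set (Sym2 V))).Reachable (a 0) v ∧
            (SimpleGraph.fromEdgeSet (↑F₂ : Set (Sym2 V))).Reachable (a 2) v
        then t ^ (F₁.card + F₂.card) else 0)
      ≤ ∑ F₁ ∈ tJoins G Set.univ {a 0, a 1}, ∑ F₂ ∈ tJoins G Set.univ {a 2, a 3},
        if (SimpleGraph.fromEdgeSet ((↑F₁ : Set (Sym2 V)) ∪ ↑F₂)).Reachable (a 0) (a 2)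
        then t ^ (F₁.card + F₂.card) else 0 := by
  refine Finset.sum_le_sum fun F₁ _ => Finset.sum_le_sum fun F₂ _ => ?_
  split_ifs with h1 h2 h2
  · exact le_rfl
  · obtain ⟨v, h0v, h2v⟩ := h1
    exact absurd ((h0v.mono (fromEdgeSet_mono Set.subset_union_left)).trans
      (h2v.mono (fromEdgeSet_mono Set.subset_union_right)).symm) h2
  · exact pow_nonneg ht _
  · exact le_rfl

/-- **The finite-graph algebra of the transfer.**  On a finite graph with `β ≥ 0`, `t = tanh β`, four
distinct marked vertices `a`: the separation bound `Z^{01}Z^{23} − meetSum ≤ sepSum · Z⁰`, the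
pairing-symmetry conclusions `3 sepSum ≤ Z^{0123}`, `Z^{02}Z^{13} = Z^{01}Z^{23} = Z^{03}Z^{12}`, and
the `U₄` bound `U₄ ≤ −c ⟨σ₀σ₁⟩⟨σ₂σ₃⟩` give `(c/3) Z^{01} Z^{23} ≤ jointSum`.  The high-temperature
expansions `⟨σ_B⟩^free_G = Z^B/Z⁰` (`isingCorr_free_eq_hteSum_div`,
`DepletionBound.loopO1PartitionFunction_eq_hteSum`) turn `nPoint`, `twoPoint` and `isingCorr` into
ratios of loop-O(1) partition functions; the rest is linear arithmetic after clearing `(Z⁰)² > 0`. -/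
theorem joint_ge_of_sep_sym_u4 {β c : ℝ} (hβ : 0 ≤ β) (a : Fin 4 → V) (ha : Function.Injective a)
    (hsep : loopO1PartitionFunction G (Real.tanh β) {a 0, a 1} *
          loopO1PartitionFunction G (Real.tanh β) {a 2, a 3}
        - (∑ F₁ ∈ tJoins G Set.univ {a 0, a 1}, ∑ F₂ ∈ tJoins G Set.univ {a 2, a 3},
            if ∃ v : V, (SimpleGraph.fromEdgeSet (↑F₁ : Set (Sym2 V))).Reachable (a 0) v ∧
                (SimpleGraph.fromEdgeSet (↑F₂ : Set (Sym2 V))).Reachable (a 2) v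
            then Real.tanh β ^ (F₁.card + F₂.card) else 0)
        ≤ (∑ D ∈ (tJoins G Set.univ (Finset.univ.image a)).filter (fun D : Finset (Sym2 V) =>
            ¬ (SimpleGraph.fromEdgeSet (↑D : Set (Sym2 V))).Reachable (a 0) (a 2) ∧
            ¬ (SimpleGraph.fromEdgeSet (↑D : Set (Sym2 V))).Reachable (a 0) (a 3)),
            Real.tanh β ^ D.card) * loopO1PartitionFunction G (Real.tanh β) ∅)
    (hsym : 3 * (∑ D ∈ (tJoins G Set.univ (Finset.univ.image a)).filter (fun D : Finset (Sym2 V) =>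
            ¬ (SimpleGraph.fromEdgeSet (↑D : Set (Sym2 V))).Reachable (a 0) (a 2) ∧
            ¬ (SimpleGraph.fromEdgeSet (↑D : Set (Sym2 V))).Reachable (a 0) (a 3)),
            Real.tanh β ^ D.card)
          ≤ loopO1PartitionFunction G (Real.tanh β) (Finset.univ.image a) ∧
      loopO1PartitionFunction G (Real.tanh β) {a 0, a 2} *
          loopO1PartitionFunction G (Real.tanh β) {a 1, a 3} =
        loopO1PartitionFunction G (Real.tanh β) {a 0, a 1} *
          loopO1PartitionFunction G (Real.tanh β) {a 2, a 3} ∧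
      loopO1PartitionFunction G (Real.tanh β) {a 0, a 3} *
          loopO1PartitionFunction G (Real.tanh β) {a 1, a 2} =
        loopO1PartitionFunction G (Real.tanh β) {a 0, a 1} *
          loopO1PartitionFunction G (Real.tanh β) {a 2, a 3})
    (hU : connectedFour (isingMeasure G Finset.univ β 0 .free) spinAt a
        ≤ -(c * isingCorr G Finset.univ β 0 .free {a 0, a 1} *
            isingCorr G Finset.univ β 0 .free {a 2, a 3})) :
    c / 3 * loopO1PartitionFunction G (Real.tanh β) {a 0, a 1} *
        loopO1PartitionFunction G (Real.tanh β) {a 2, a 3} ≤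
      ∑ F₁ ∈ tJoins G Set.univ {a 0, a 1}, ∑ F₂ ∈ tJoins G Set.univ {a 2, a 3},
        if (SimpleGraph.fromEdgeSet ((↑F₁ : Set (Sym2 V)) ∪ ↑F₂)).Reachable (a 0) (a 2)
        then Real.tanh β ^ (F₁.card + F₂.card) else 0 := by
  obtain ⟨h3, h0213, h0312⟩ := hsym
  have ht : 0 ≤ Real.tanh β := by
    rw [Real.tanh_eq_sinh_div_cosh]
    exact div_nonneg (Real.sinh_nonneg_iff.2 hβ) (Real.cosh_pos _).le
  have hmeet := meetSum_le_jointSum G ht a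
  have hZ0 : 0 < loopO1PartitionFunction G (Real.tanh β) ∅ := loopO1PartitionFunction_empty_pos G ht
  -- high-temperature expansion on the whole vertex set: `⟨σ_A⟩^free_G = Z^A / Z⁰`
  have hcorr : ∀ A : Finset V, isingCorr G Finset.univ β 0 .free A =
      loopO1PartitionFunction G (Real.tanh β) A / loopO1PartitionFunction G (Real.tanh β) ∅ :=
    fun A => by
      rw [isingCorr_free_eq_hteSum_div G Finset.univ β (Finset.subset_univ A),
        DepletionBound.loopO1PartitionFunction_eq_hteSum,
        DepletionBound.loopO1PartitionFunction_eq_hteSum]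
  -- the four-point expansion (`spinMonomial a = spinProduct (image a)` for injective `a`)
  have e4 : nPoint (isingMeasure G Finset.univ β 0 .free) spinAt a =
      loopO1PartitionFunction G (Real.tanh β) (Finset.univ.image a) /
        loopO1PartitionFunction G (Real.tanh β) ∅ := by
    have hmono : spinMonomial a = spinProduct (Finset.univ.image a) := by
      funext s
      unfold spinMonomial spinProduct
      rw [Finset.prod_image fun i _ j _ h => ha h]
    rw [← hcorr, isingCorr, ← hmono]
    rfl
  -- the six pair expansions (`σ_x σ_y = σ_{{x,y}}` for `x ≠ y`)
  have e2 : ∀ x y : V, x ≠ y → twoPoint (isingMeasure G Finset.univ β 0 .free) spinAt x y =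
      loopO1PartitionFunction G (Real.tanh β) {x, y} / loopO1PartitionFunction G (Real.tanh β) ∅ :=
    fun x y hxy => by
      rw [← hcorr, ← isingTwoPoint_eq_isingCorr G Finset.univ β 0 .free hxy]
      rfl
  have e01 := e2 _ _ (ha.ne (by decide) : a 0 ≠ a 1)
  have e23 := e2 _ _ (ha.ne (by decide) : a 2 ≠ a 3)
  have e02 := e2 _ _ (ha.ne (by decide) : a 0 ≠ a 2)
  have e13 := e2 _ _ (ha.ne (by decide) : a 1 ≠ a 3)
  have e03 := e2 _ _ (ha.ne (by decide) : a 0 ≠ a 3)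
  have e12 := e2 _ _ (ha.ne (by decide) : a 1 ≠ a 2)
  -- abbreviations
  set Z0 := loopO1PartitionFunction G (Real.tanh β) ∅ with hZ0_def
  set ZA := loopO1PartitionFunction G (Real.tanh β) (Finset.univ.image a) with hZA_def
  set Z01 := loopO1PartitionFunction G (Real.tanh β) {a 0, a 1} with hZ01_def
  set Z23 := loopO1PartitionFunction G (Real.tanh β) {a 2, a 3} with hZ23_def
  set Z02 := loopO1PartitionFunction G (Real.tanh β) {a 0, a 2} with hZ02_def
  set Z13 := loopO1PartitionFunction G (Real.tanh β) {a 1, a 3} with hZ13_def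
  set Z03 := loopO1PartitionFunction G (Real.tanh β) {a 0, a 3} with hZ03_def
  set Z12 := loopO1PartitionFunction G (Real.tanh β) {a 1, a 2} with hZ12_def
  have hZ0' : Z0 ≠ 0 := hZ0.ne'
  -- `U₄ (Z⁰)² = Z^A Z⁰ − Z01 Z23 − Z02 Z13 − Z03 Z12`
  have hU4 : connectedFour (isingMeasure G Finset.univ β 0 .free) spinAt a =
      (ZA * Z0 - Z01 * Z23 - Z02 * Z13 - Z03 * Z12) / Z0 ^ 2 := by
    unfold connectedFour
    rw [e4, e01, e23, e02, e13, e03, e12]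
    field_simp
  have hG : -(c * isingCorr G Finset.univ β 0 .free {a 0, a 1} *
      isingCorr G Finset.univ β 0 .free {a 2, a 3}) = -(c * (Z01 * Z23)) / Z0 ^ 2 := by
    rw [hcorr, hcorr]
    ring
  rw [hU4, hG, div_le_div_iff_of_pos_right (pow_pos hZ0 2), h0213, h0312] at hU
  -- `hU : ZA * Z0 - Z01 * Z23 - Z01 * Z23 - Z01 * Z23 ≤ -(c * (Z01 * Z23))`
  have h3' := mul_le_mul_of_nonneg_right h3 hZ0.le
  linarith [hsep, h3', hU, hmeet]

end StubTransfer

open Summit.CriticalPhenomena.Ising3DConformalLimit.Cruxes.ParityRobustMerging.PlaquetteXorSurgery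
  (tetra_injective tanh_criticalBeta_nonneg)

/-- **Stub 6 of the line `Sketch` of the crux `IndependentStrandsJoin` (the transfer).**
Separation bound + pairing symmetry + box symmetry + `TetraU4Lattice` give the crux's statement with
constant `c/3`: in the box, `U₄ (Z⁰)² = Z^{0123} Z⁰ − 3 Z^{01}Z^{23}` (HT expansions
`nPoint = Z^{0123}/Z⁰`, `twoPoint = Z^{xy}/Z⁰`, and the two `Z`-identities of the symmetry), so
`3 (Z^{01}Z^{23} − meetSum) ≤ 3 sepSum Z⁰ ≤ Z^{0123} Z⁰ = 3 Z^{01}Z^{23} + U₄ (Z⁰)² ≤ (3 − c) Z^{01}Z^{23}`,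
i.e. `meetSum ≥ (c/3) Z^{01} Z^{23}`, and `meetSum ≤ jointSum` termwise (a shared vertex `v` joins
`a₀ ↝_{F₁} v ↝_{F₂} a₂`).  The conclusion is the body of the route decl `IndependentStrandsJoin`,
verbatim. -/
theorem stub_transfer :
    (∀ (V : Type) [Fintype V] [DecidableEq V] (G : SimpleGraph V) [DecidableRel G.Adj] (β : ℝ),
      0 ≤ β → ∀ a : Fin 4 → V, Function.Injective a →
      loopO1PartitionFunction G (Real.tanh β) {a 0, a 1} * loopO1PartitionFunction G (Real.tanh β) {a 2, a 3}
        - (∑ F₁ ∈ tJoins G Set.univ {a 0, a 1}, ∑ F₂ ∈ tJoins G Set.univ {a 2, a 3},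
            if ∃ v : V, (SimpleGraph.fromEdgeSet (↑F₁ : Set (Sym2 V))).Reachable (a 0) v ∧
                (SimpleGraph.fromEdgeSet (↑F₂ : Set (Sym2 V))).Reachable (a 2) v
            then Real.tanh β ^ (F₁.card + F₂.card) else 0)
        ≤ (∑ D ∈ (tJoins G Set.univ (Finset.univ.image a)).filter (fun D : Finset (Sym2 V) =>
            ¬ (SimpleGraph.fromEdgeSet (↑D : Set (Sym2 V))).Reachable (a 0) (a 2) ∧
            ¬ (SimpleGraph.fromEdgeSet (↑D : Set (Sym2 V))).Reachable (a 0) (a 3)),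
            Real.tanh β ^ D.card) * loopO1PartitionFunction G (Real.tanh β) ∅) →
    (∀ (V : Type) [Fintype V] [DecidableEq V] (G : SimpleGraph V) [DecidableRel G.Adj] (t : ℝ),
      0 ≤ t → ∀ a : Fin 4 → V, Function.Injective a →
      (∃ φ : G ≃g G, φ (a 0) = a 0 ∧ φ (a 1) = a 2 ∧ φ (a 2) = a 1 ∧ φ (a 3) = a 3) →
      (∃ ψ : G ≃g G, ψ (a 0) = a 0 ∧ ψ (a 1) = a 3 ∧ ψ (a 3) = a 1 ∧ ψ (a 2) = a 2) →
      3 * (∑ D ∈ (tJoins G Set.univ (Finset.univ.image a)).filter (fun D : Finset (Sym2 V) =>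
            ¬ (SimpleGraph.fromEdgeSet (↑D : Set (Sym2 V))).Reachable (a 0) (a 2) ∧
            ¬ (SimpleGraph.fromEdgeSet (↑D : Set (Sym2 V))).Reachable (a 0) (a 3)),
            t ^ D.card)
          ≤ loopO1PartitionFunction G t (Finset.univ.image a) ∧
      loopO1PartitionFunction G t {a 0, a 2} * loopO1PartitionFunction G t {a 1, a 3} =
        loopO1PartitionFunction G t {a 0, a 1} * loopO1PartitionFunction G t {a 2, a 3} ∧
      loopO1PartitionFunction G t {a 0, a 3} * loopO1PartitionFunction G t {a 1, a 2} =
        loopO1PartitionFunction G t {a 0, a 1} * loopO1PartitionFunction G t {a 2, a 3}) →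
    (∀ (l N : ℕ) (a : Fin 4 → ↥(box 3 N)),
      (∀ i, ((a i : Site 3)) = (l : ℤ) •
        (![![-1, -1, -1], ![1, 1, -1], ![1, -1, 1], ![-1, 1, 1]] : Fin 4 → Site 3) i) →
      (∃ φ : ((zdGraph 3).comap (Subtype.val : ↥(box 3 N) → Site 3)) ≃g
          ((zdGraph 3).comap (Subtype.val : ↥(box 3 N) → Site 3)),
          φ (a 0) = a 0 ∧ φ (a 1) = a 2 ∧ φ (a 2) = a 1 ∧ φ (a 3) = a 3) ∧
      (∃ ψ : ((zdGraph 3).comap (Subtype.val : ↥(box 3 N) → Site 3)) ≃g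
          ((zdGraph 3).comap (Subtype.val : ↥(box 3 N) → Site 3)),
          ψ (a 0) = a 0 ∧ ψ (a 1) = a 3 ∧ ψ (a 3) = a 1 ∧ ψ (a 2) = a 2)) →
    (∃ c : ℝ, 0 < c ∧ ∀ l : ℕ, 1 ≤ l → ∃ N₀ : ℕ, ∀ N : ℕ, N₀ ≤ N → ∀ a : Fin 4 → ↥(box 3 N),
      (∀ i, ((a i : Site 3)) = (l : ℤ) •
        (![![-1, -1, -1], ![1, 1, -1], ![1, -1, 1], ![-1, 1, 1]] : Fin 4 → Site 3) i) →
      connectedFour (isingMeasure ((zdGraph 3).comap (Subtype.val : ↥(box 3 N) → Site 3))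
          Finset.univ (criticalBeta 3) 0 .free) spinAt a
        ≤ -(c * isingCorr ((zdGraph 3).comap (Subtype.val : ↥(box 3 N) → Site 3)) Finset.univ
              (criticalBeta 3) 0 .free {a 0, a 1} *
            isingCorr ((zdGraph 3).comap (Subtype.val : ↥(box 3 N) → Site 3)) Finset.univ
              (criticalBeta 3) 0 .free {a 2, a 3})) →
    (let tetra : Fin 4 → Literature.Probability.LatticeModels.Site 3 := ![![-1, -1, -1], ![1, 1, -1], ![1, -1, 1], ![-1, 1, 1]]; ∃ c : ℝ, 0 < c ∧ ∀ l : ℕ, 1 ≤ l → ∃ N₀ : ℕ, ∀ N : ℕ, N₀ ≤ N → ∀ a : Fin 4 → ↥(Literature.Probability.LatticeModels.box 3 N), (∀ i, ((a i : Literature.Probability.LatticeModels.Site 3)) = (l : ℤ) • tetra i) → (let G := ((Literature.Probability.LatticeModels.zdGraph 3).comap (Subtype.val : ↥(Literature.Probability.LatticeModels.box 3 N) → Literature.Probability.LatticeModels.Site 3)); let t : ℝ := Real.tanh (Literature.Probability.LatticeModels.criticalBeta 3); c * Literature.Probability.LatticeModels.loopO1PartitionFunction G t {a 0, a 1} * Literature.Probability.LatticeModels.loopO1PartitionFunction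 G t {a 2, a 3} ≤ ∑ F₁ ∈ Literature.Probability.LatticeModels.tJoins G Set.univ {a 0, a 1}, ∑ F₂ ∈ Literature.Probability.LatticeModels.tJoins G Set.univ {a 2, a 3}, if (SimpleGraph.fromEdgeSet ((↑F₁ : Set (Sym2 ↥(Literature.Probability.LatticeModels.box 3 N))) ∪ ↑F₂)).Reachable (a 0) (a 2) then t ^ (F₁.card + F₂.card) else 0)) := by
  intro hSep hSym hBox hU4
  obtain ⟨c, hc, hU⟩ := hU4
  refine ⟨c / 3, by positivity, fun l hl => ?_⟩
  obtain ⟨N₀, hN⟩ := hU l hl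
  refine ⟨N₀, fun N hN' a ha => ?_⟩
  have hβ : 0 ≤ criticalBeta 3 := criticalBeta_nonneg 3
  have ha' : Function.Injective a := tetra_injective hl a ha
  obtain ⟨hφ, hψ⟩ := hBox l N a ha
  have hS := hSym ↥(box 3 N) ((zdGraph 3).comap (Subtype.val : ↥(box 3 N) → Site 3))
    (Real.tanh (criticalBeta 3)) tanh_criticalBeta_nonneg a ha' hφ hψ
  have hP := hSep ↥(box 3 N) ((zdGraph 3).comap (Subtype.val : ↥(box 3 N) → Site 3))
    (criticalBeta 3) hβ a ha'
  exact StubTransfer.joint_ge_of_sep_sym_u4 ((zdGraph 3).comap (Subtype.val : ↥(box 3 N) → Site 3))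
    hβ a ha' hP hS (hN N hN' a ha)

end Summit.CriticalPhenomena.Ising3DConformalLimit.Theorems

end
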